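import Summits.Ventures.PercRepro.ProfileGapMonoThresholdWeakAvgZeroBounds
import Summits.Ventures.PercRepro.ProfileGapMonoThresholdComplement

/-!
# PercRepro — THE WEAK AVERAGED STEP AT THE OFFSETS `0` AND `−1` OF CO-RANK `2` IS A THEOREM:
`WeakAvgStepT α 2 2` AND `WeakAvgStepT α 2 1` (p5, gen 28; `proofs/P5-GM1.md` §29)

The per-set bounds of `ProfileGapMonoThresholdWeakAvgZeroBounds`, summed class by class (`sum_fibre_le_two`: in
the class `P` of a rank-`1` set the singletons pay up to `2` short each, only when `ρ(E∖b) ≥ 4`, which forces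
`ρ(E∖P) ≥ 3`, and the full class `P` pays `2 #P` extra), with the validity of the shares
(`sum_share_le_sum_weight_gen`) and the deletion counts (`sum_card_levelSetCoQ_delete_add_le`,
`sum_thresholdSum_delete_eq`): the weak averaged step `Σ_{z ∈ E} Φ_2(N ∖ z) ≤ #E · Φ_2(N)` at co-rank `2` on every
loopless matroid (`weakAvg_two_two_of_loopless`); loops reduce by `weakAvg_step_of_loop` with `thresholdIneq_two`,
and the induction on `#E` gives **`weakAvgStepT_two_two : WeakAvgStepT α 2 2`** on EVERY finite matroid.  By the
complement identity `Φ_{q−1} = Φ_q` (`thresholdSum_pred_eq_add`, `card_levelSetCoQ_pred_eq_add`) the steps at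
the offsets `−1` and `0` coincide (`weakAvgStepT_pred_iff`, every `q ≥ 1`), whence
**`weakAvgStepT_two_one : WeakAvgStepT α 2 1`**.  With `weakAvgStepT_two_three` the weak averaged step holds at
co-rank `2` at every threshold `t ∈ {1, 2, 3}` of the family's range; the deletion rules `DelMonoRuleT α 2 2`,
`DelMonoRuleT α 2 1` and the threshold inequalities follow.
-/

open scoped Matroid

namespace PercRepro.Cogirth

open Finset ThmH Skew Shadow Profile

variable {α : Type} [DecidableEq α] {N : Matroid α} [N.Finite]

section Fibre

/-- **One class balances at the threshold `2`**: over the rank-`1` sets `B` with `clF N B = P`, the demand is at most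
the surviving demand plus the credited shares (`[3 ≤ ρ(E∖B)] · supply B`). -/
theorem sum_fibre_le_two (hloop : ∀ x ∈ gr N, rk N {x} = 1) {B₀ : Finset α} (hB₀ : B₀ ∈ Rq N 1) :
    ∑ B ∈ (Rq N 1).filter (fun B => clF N B = clF N B₀),
        (gr N).card * (if 3 ≤ rk N (gr N \ B) then rk N (gr N \ B) else 0) ≤
      ∑ B ∈ (Rq N 1).filter (fun B => clF N B = clF N B₀),
        (((gr N \ B).card - (coloops N (gr N \ B)).card) *
            (if 3 ≤ rk N (gr N \ B) then rk N (gr N \ B) else 0) +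
          (coloops N (gr N \ B)).card *
            (if 3 ≤ rk N (gr N \ B) - 1 then rk N (gr N \ B) - 1 else 0) +
          (if 3 ≤ rk N (gr N \ B) then
            ∑ y ∈ gr N \ clF N B,
              (if B.card = 1 ∧ 3 ≤ rk N (gr N \ {y}) then 1 else 2) *
                ((insert y B).card +
                  (if rk N (gr N \ insert y B) = 2 then (coloops N (gr N \ insert y B)).card else 0))
          else 0)) := by
  set P := clF N B₀ with hPdef
  set fib := (Rq N 1).filter (fun B => clF N B = P) with hfib
  obtain ⟨hPRq, hPP⟩ := clF_mem_Rq_one hB₀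
  have hPfib : P ∈ fib := by rw [hfib, mem_filter]; exact ⟨hPRq, hPP⟩
  -- the per-set bounds, with the correction `c B = [#B = 1 ∧ 2 ≤ #P ∧ 4 ≤ ρ(E∖B)] · 2`
  have hterm : ∀ B ∈ fib,
      (gr N).card * (if 3 ≤ rk N (gr N \ B) then rk N (gr N \ B) else 0) ≤
        (((gr N \ B).card - (coloops N (gr N \ B)).card) *
            (if 3 ≤ rk N (gr N \ B) then rk N (gr N \ B) else 0) +
          (coloops N (gr N \ B)).card *
            (if 3 ≤ rk N (gr N \ B) - 1 then rk N (gr N \ B) - 1 else 0) +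
          (if 3 ≤ rk N (gr N \ B) then
            ∑ y ∈ gr N \ clF N B,
              (if B.card = 1 ∧ 3 ≤ rk N (gr N \ {y}) then 1 else 2) *
                ((insert y B).card +
                  (if rk N (gr N \ insert y B) = 2 then (coloops N (gr N \ insert y B)).card else 0))
          else 0)) +
        (if B.card = 1 ∧ 2 ≤ (clF N B).card ∧ 4 ≤ rk N (gr N \ B) then 2 else 0) := by
    intro B hB
    rw [hfib, mem_filter] at hB
    obtain ⟨hB, hBP⟩ := hB
    by_cases h3 : 3 ≤ rk N (gr N \ B)
    · by_cases h1 : B.card = 1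
      · obtain ⟨b, rfl⟩ := card_eq_one.1 h1
        have hb : b ∈ gr N := (mem_Rq.1 hB).1 (mem_singleton_self b)
        by_cases hP2 : 2 ≤ (clF N {b}).card
        · have := point_bound_singleton_big_two hloop hb hP2
          simp only [h3, hP2, card_singleton, true_and, if_true] at this ⊢
          split_ifs at this ⊢ <;> omega
        · have hP1 : (clF N {b}).card = 1 := by
            have : 1 ≤ (clF N {b}).card :=
              card_pos.2 ⟨b, subset_clF (singleton_subset_iff.2 hb) (mem_singleton_self b)⟩
            omega
          have := point_bound_singleton_small_two hloop hb hP1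
          simp only [h3, hP2, card_singleton, true_and, false_and, if_true, if_false, add_zero] at this ⊢
          omega
      · have h2 : 2 ≤ B.card := by
          have : 1 ≤ B.card := by
            rw [mem_Rq] at hB
            have := rk_le_card (M := N) B
            rw [rk_eq_of_eRk_eq_cq hB.2] at this
            exact this
          omega
        have := point_bound_two_le_two hloop hB h2
        simp only [h3, h1, false_and, if_true, if_false, add_zero] at this ⊢
        omega
    · have h4 : ¬ (4 ≤ rk N (gr N \ B)) := by omega
      have h31 : ¬ (3 ≤ rk N (gr N \ B) - 1) := by omega
      simp only [h3, h4, h31, if_false, and_false, mul_zero, add_zero, le_refl]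
  -- the corrections: at most `2 #P`, and only when `P` is demanding with `#P ≥ 2`
  set D := fib.filter (fun B => B.card = 1 ∧ 2 ≤ (clF N B).card ∧ 4 ≤ rk N (gr N \ B)) with hDdef
  have hcsum : ∑ B ∈ fib, (if B.card = 1 ∧ 2 ≤ (clF N B).card ∧ 4 ≤ rk N (gr N \ B) then 2 else 0) =
      D.card * 2 := by
    rw [← sum_filter, sum_const, smul_eq_mul]
  have hDP : D.card ≤ P.card := by
    have hsub : D ⊆ P.image (fun b => ({b} : Finset α)) := by
      intro B hB
      rw [hDdef, mem_filter, hfib, mem_filter] at hB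
      obtain ⟨⟨hBRq, hBP⟩, hB1, _⟩ := hB
      obtain ⟨b, rfl⟩ := card_eq_one.1 hB1
      rw [mem_image]
      refine ⟨b, ?_, rfl⟩
      rw [← hBP]
      exact subset_clF (mem_Rq.1 hBRq).1 (mem_singleton_self b)
    exact (card_le_card hsub).trans card_image_le
  -- split both sums at `P`
  rw [← add_sum_erase fib _ hPfib, ← add_sum_erase fib _ hPfib]
  have hrest := sum_le_sum (s := fib.erase P) (fun B hB => hterm B (mem_of_mem_erase hB))
  rw [sum_add_distrib] at hrest
  have hcle : ∑ B ∈ fib.erase P, (if B.card = 1 ∧ 2 ≤ (clF N B).card ∧ 4 ≤ rk N (gr N \ B) then 2 else 0) ≤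
      D.card * 2 := by
    rw [← hcsum]
    exact sum_le_sum_of_subset_of_nonneg (erase_subset _ _) (fun _ _ _ => Nat.zero_le _)
  rcases D.eq_empty_or_nonempty with hD | ⟨B₁, hB₁⟩
  · -- no correction anywhere: the term at `P` itself is bounded by `hterm` with correction `0`
    rw [hD, card_empty] at hcle
    have hP := hterm P hPfib
    have hcP : (if P.card = 1 ∧ 2 ≤ (clF N P).card ∧ 4 ≤ rk N (gr N \ P) then 2 else 0) = 0 := by
      have : P ∉ D := by rw [hD]; exact notMem_empty _
      rw [hDdef, mem_filter] at this
      split_ifs with h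
      · exact absurd ⟨hPfib, h⟩ this
      · rfl
    rw [hcP] at hP
    omega
  · -- a singleton `{b₁}` of `P` with `ρ(E∖b₁) ≥ 4`: `#P ≥ 2` and `ρ(E∖P) ≥ 3`, so `P` pays `2 #P` extra
    rw [hDdef, mem_filter, hfib, mem_filter] at hB₁
    obtain ⟨⟨hB₁Rq, hB₁P⟩, hB₁1, hP2', hB₁4⟩ := hB₁
    rw [hB₁P] at hP2'
    obtain ⟨b₁, rfl⟩ := card_eq_one.1 hB₁1
    have hb₁ : b₁ ∈ gr N := (mem_Rq.1 hB₁Rq).1 (mem_singleton_self b₁)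
    have hr₁ : rk N {b₁} = 1 := hloop b₁ hb₁
    have h3P : 3 ≤ rk N (gr N \ P) := by
      have := rk_sdiff_le_rk_sdiff_clF_add_one (N := N) hr₁ {b₁}
      rw [hB₁P] at this
      omega
    have hclass := point_bound_class_two hPRq hP2' hPP h3P
    rw [hPP, ← hPdef] at hclass
    have hPP' : clF N P = P := hPP
    rw [hPP']
    simp only [if_pos h3P] at hclass ⊢
    omega

end Fibre

section Theorem

/-- **The weak averaged step at `(2, 2)` on every loopless matroid.** -/
theorem weakAvg_two_two_of_loopless (hloop : ∀ x ∈ gr N, rk N {x} = 1) :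
    ∑ z ∈ gr N, 2 * (levelSetCoQ (N ＼ ({z} : Set α)) 2 2).card + (gr N).card * thresholdSum N 2 2 ≤
      ∑ z ∈ gr N, thresholdSum (N ＼ ({z} : Set α)) 2 2 + (gr N).card * (2 * (levelSetCoQ N 2 2).card) := by
  -- the supply side: the deletion count of `T_2` with the lost sets
  have hS := sum_card_levelSetCoQ_delete_add_le (M := N) 2 2
  have hT2 : 2 * (levelSetCoQ N 2 2).card ≤ ∑ S ∈ levelSetCoQ N 2 2, S.card := by
    rw [mul_comm, ← smul_eq_mul, ← sum_const]
    apply sum_le_sum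
    intro S hS
    rw [mem_levelSetCoQ] at hS
    have h := rk_le_card (M := N) S
    rw [rk_eq_of_eRk_eq_cq hS.1.2] at h
    exact h
  -- the demand side: the per-set expansion, regrouped by classes
  have h23 : (2 : ℕ) + 1 = 3 := rfl
  have h21 : (2 : ℕ) - 1 = 1 := rfl
  have hdem : (gr N).card * thresholdSum N 2 2 ≤
      ∑ z ∈ gr N, thresholdSum (N ＼ ({z} : Set α)) 2 2 +
        ∑ B ∈ (Rq N 1).filter (fun B => 3 ≤ rk N (gr N \ B)), ∑ y ∈ gr N \ clF N B,
          (if B.card = 1 ∧ 3 ≤ rk N (gr N \ {y}) then 1 else 2) *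
            ((insert y B).card +
              (if rk N (gr N \ insert y B) = 2 then (coloops N (gr N \ insert y B)).card else 0)) := by
    rw [sum_thresholdSum_delete_eq]
    unfold thresholdSum
    rw [mul_sum, sum_congr rfl (fun B _ => sum_threshold_erase (M := N) (X := gr N \ B) sdiff_subset 2)]
    simp only [h23, h21]
    rw [sum_filter, ← sum_add_distrib]
    -- regroup by the classes
    rw [← sum_fiberwise_of_maps_to (s := Rq N 1) (t := (Rq N 1).image (clF N)) (g := clF N)
        (fun B hB => mem_image_of_mem _ hB),
      ← sum_fiberwise_of_maps_to (s := Rq N 1) (t := (Rq N 1).image (clF N)) (g := clF N)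
        (fun B hB => mem_image_of_mem _ hB)]
    apply sum_le_sum
    intro P hP
    obtain ⟨B₀, hB₀, rfl⟩ := mem_image.1 hP
    exact sum_fibre_le_two hloop hB₀
  -- the validity of the shares
  have hval := sum_share_le_sum_weight_gen hloop 2
  simp only [h23] at hval
  have hw : ∑ S ∈ levelSetCoQ N 2 2,
      2 * (S.card + (if rk N (gr N \ S) = 2 then (coloops N (gr N \ S)).card else 0)) =
      2 * (∑ S ∈ levelSetCoQ N 2 2, S.card +
        ∑ S ∈ (levelSetCoQ N 2 2).filter (fun S => rk N (gr N \ S) = 2), (coloops N (gr N \ S)).card) := by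
    rw [← mul_sum, sum_add_distrib, sum_filter]
  rw [hw] at hval
  rw [← mul_sum, Nat.mul_left_comm (gr N).card 2]
  omega

/-- The induction on `#E`: loops reduce by `weakAvg_step_of_loop`, loopless matroids are
`weakAvg_two_two_of_loopless`. -/
theorem weakAvg_two_two_aux' (n : ℕ) :
    ∀ (N : Matroid α) [N.Finite], (gr N).card = n →
      ∑ z ∈ gr N, 2 * (levelSetCoQ (N ＼ ({z} : Set α)) 2 2).card + (gr N).card * thresholdSum N 2 2 ≤
        ∑ z ∈ gr N, thresholdSum (N ＼ ({z} : Set α)) 2 2 + (gr N).card * (2 * (levelSetCoQ N 2 2).card) := by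
  induction n using Nat.strong_induction_on with
  | _ n ih =>
  intro N _ hN
  by_cases hloop : ∃ ℓ ∈ gr N, rk N {ℓ} = 0
  · obtain ⟨ℓ, hℓ, h0⟩ := hloop
    have hlt : ((gr N).erase ℓ).card < n := by rw [← hN]; exact card_erase_lt_of_mem hℓ
    have hW := ih _ hlt (N ＼ ({ℓ} : Set α)) (by rw [gr_delete'])
    exact weakAvg_step_of_loop hℓ h0 (thresholdIneq_two _ (by norm_num)) hW
  · have hloop' : ∀ x ∈ gr N, rk N {x} = 1 := by
      intro x hx
      have h2 : rk N {x} ≠ 0 := fun h => hloop ⟨x, hx, h⟩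
      have h3 : rk N {x} ≤ 1 := by
        have := rk_le_card (M := N) ({x} : Finset α)
        simpa using this
      omega
    exact weakAvg_two_two_of_loopless hloop'

/-- **THE WEAK AVERAGED STEP AT `(q, t) = (2, 2)` IS A THEOREM**: `WeakAvgStepT α 2 2` — on every finite matroid,
`Σ_{z ∈ E} Φ_2(N ∖ z) ≤ #E · Φ_2(N)` at co-rank `2` (the offset `0`, the row `(1, 2)`). -/
theorem weakAvgStepT_two_two : WeakAvgStepT α 2 2 := fun N _ => weakAvg_two_two_aux' _ N rfl

/-- **The deletion rule at `(2, 2)` on every finite matroid**, from the averaged step. -/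
theorem delMonoRuleT_two_two : DelMonoRuleT α 2 2 :=
  delMonoRuleT_of_weakAvgStepT weakAvgStepT_two_two

/-- `(I_2)` at co-rank `2` again, now through the averaged step. -/
theorem thresholdIneq_two_two' (N : Matroid α) [N.Finite] : ThresholdIneq N 2 2 :=
  thresholdIneq_of_weakAvgStepT weakAvgStepT_two_two N

end Theorem

section Pred

variable {q : ℕ}

/-- **The steps at the offsets `−1` and `0` coincide at every matroid** (`1 ≤ q`): by the complement identity
`Φ_{q−1} = Φ_q` the same correction `q · #{B : ρ(B) = q − 1, ρ(E∖B) = q}` is added to both sides, for `N` and for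
every `N ∖ z`. -/
theorem weakAvg_pred_iff (hq : 1 ≤ q) (N : Matroid α) [N.Finite] :
    (∑ z ∈ gr N, q * (levelSetCoQ (N ＼ ({z} : Set α)) (q - 1) q).card +
        (gr N).card * thresholdSum N q (q - 1) ≤
      ∑ z ∈ gr N, thresholdSum (N ＼ ({z} : Set α)) q (q - 1) +
        (gr N).card * (q * (levelSetCoQ N (q - 1) q).card)) ↔
    (∑ z ∈ gr N, q * (levelSetCoQ (N ＼ ({z} : Set α)) q q).card + (gr N).card * thresholdSum N q q ≤
      ∑ z ∈ gr N, thresholdSum (N ＼ ({z} : Set α)) q q + (gr N).card * (q * (levelSetCoQ N q q).card)) := by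
  have h1 : ∀ z ∈ gr N, q * (levelSetCoQ (N ＼ ({z} : Set α)) (q - 1) q).card =
      q * (levelSetCoQ (N ＼ ({z} : Set α)) q q).card +
        q * ((Rq (N ＼ ({z} : Set α)) (q - 1)).filter
          (fun B => rk (N ＼ ({z} : Set α)) (gr (N ＼ ({z} : Set α)) \ B) = q)).card := by
    intro z _
    rw [card_levelSetCoQ_pred_eq_add hq, mul_add]
  have h2 : ∀ z ∈ gr N, thresholdSum (N ＼ ({z} : Set α)) q (q - 1) =
      thresholdSum (N ＼ ({z} : Set α)) q q +
        q * ((Rq (N ＼ ({z} : Set α)) (q - 1)).filter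
          (fun B => rk (N ＼ ({z} : Set α)) (gr (N ＼ ({z} : Set α)) \ B) = q)).card := by
    intro z _
    rw [thresholdSum_pred_eq_add hq]
  rw [sum_congr rfl h1, sum_congr rfl h2, sum_add_distrib, sum_add_distrib,
    thresholdSum_pred_eq_add (N := N) hq, card_levelSetCoQ_pred_eq_add (N := N) hq, mul_add, mul_add, mul_add]
  constructor <;> intro h <;> linarith

/-- **`WeakAvgStepT` at the offsets `−1` and `0` coincide** (`1 ≤ q`). -/
theorem weakAvgStepT_pred_iff (hq : 1 ≤ q) : WeakAvgStepT α q (q - 1) ↔ WeakAvgStepT α q q := by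
  unfold WeakAvgStepT
  constructor
  · intro h N _
    exact (weakAvg_pred_iff hq N).1 (h N)
  · intro h N _
    exact (weakAvg_pred_iff hq N).2 (h N)

/-- **THE WEAK AVERAGED STEP AT `(q, t) = (2, 1)` IS A THEOREM**: `WeakAvgStepT α 2 1` (the offset `−1` of
co-rank `2`), from `weakAvgStepT_two_two` by the complement identity. -/
theorem weakAvgStepT_two_one : WeakAvgStepT α 2 1 :=
  (weakAvgStepT_pred_iff (α := α) (q := 2) (by norm_num)).2 weakAvgStepT_two_two

/-- **The deletion rule at `(2, 1)` on every finite matroid.** -/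
theorem delMonoRuleT_two_one : DelMonoRuleT α 2 1 :=
  delMonoRuleT_of_weakAvgStepT weakAvgStepT_two_one

/-- `(I_1)` at co-rank `2` — the row `(1, 2)` — through the averaged step. -/
theorem thresholdIneq_two_one' (N : Matroid α) [N.Finite] : ThresholdIneq N 2 1 :=
  thresholdIneq_of_weakAvgStepT weakAvgStepT_two_one N

end Pred

end PercRepro.Cogirth
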